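import Summits.QuantumFields.BalabanUV.Beta.GAN24.MonotoneTorusEffectiveLimit
import Literature.MathematicalPhysics.QuantumFieldTheory.Balaban1983to89.B5ActionRate166

/-!
# Beta / GAN24 / MonotoneTorusRate — ROAD P4's TORUS AVATAR WITH A RATE: `effAction k ≤ effInf ≤ effAction k + Crate·Lc^{−2k}·curlᴴcurl`
# in the Loewner order (U = 1, every torus, every `d`, `Lc ≥ 2`) — the «one datum» of the monotone road made EXPLICIT and geometric,
# `θ = Lc⁻²`, by junction with the tree's UNCONDITIONAL rate `B5ActionRate166.formDk_limit` (binder row G-an2-4 ∕ (CONV-C); road P2 seat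
# gan24-p2 gen 28, auditing candidate route R1 of `HOME/beta/ROUTES-GAN24.md` v1; NOT IN PRINT — our proof attempt)

HONEST FRAMING (page 1 of everything the β sub-cell writes): discharging `BetaPertH` makes Bałaban's UV stability UNCONDITIONAL — a
real constructive-QFT result; it is NOT the continuum limit and NOT the Clay problem.  HONEST DEPENDENCY (cell reorg 2026-08-19, verbatim):
«continuum YM on T⁴ ⇐ BetaPertH ∧ nine spine estimates (0/9 proved); BetaPertH ⇐ (D1) ∧ (D4) ∧ CAP+tail; G-an2-4 gates asym, D1 and NE2/3/4.»
HONEST LABEL: «not in print; our proof attempt»; 0 wall binders instantiated; NEVER «G-an2-4 closed».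

ABSOLUTE RULE (cell charter, verbatim): "No internally-minted statement may enter as a cited fact. Every hypothesis is either
kernel-proved in this package or a verbatim quotation of a PUBLISHED theorem with page reference. The manuscript(s) under audit are
NOT citable for their own disputed steps — they are the thing under adjudication; programme-internal (2001/route/tribunal) claims
are never citable."  Nothing is cited; every declaration is [folklore] glue over tree theorems used BY NAME; no `def … : Prop`.

## WHY (route audit, `HOME/b2b-balaban-gan24-p2/gen28/ROUTE-AUDIT-P2.md` §3)
Road P4 (`MonotoneTorusEffective`, `MonotoneTorusEffectiveLimit`) proves, hypothesis-free, that Bałaban's effective actions `effAction k = 2Δ_{Lc^k}`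
((1.65)∕(1.66) at `U = 1`, hard constraint, torus `Tor M`) INCREASE in the Loewner order to a limit `effInf = 2Δ_∞` — «monotone, NO RATE» (its §2 says
verbatim: «no rate (the tree's `formDk_limit` rate `L^{−2k}` is not used)»).  Candidate route R1 of `ROUTES-GAN24.md` v1 («monotone + trial-subspace
squeeze») promises exactly the missing rate `effAction j ≤ effInf ≤ effAction j + C·Lc^{−2j}` by a variational comparison.  THIS FILE records that, at
`U = 1`, that conclusion is ALREADY a corollary of two tree theorems BY NAME — b05∕asym1's `B5ActionRate166.formDk_limit` (`|formDk (L^k) M B − F_∞| ≤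
Crate(d)·L^{−2k}·d1Sq M B`, every torus, `L ≥ 2`, unconditional) and P4's junction `MonotoneTorusEffectiveLimit.half_effInf_quad_eq_formDk_limit`
(`½re⟨B, effInf B⟩ = F_∞`) — so R1's NEW content is re-scoped to its minimiser∕energy-norm statements (S6) and its `U ≠ 1` structure (audit §3).

## WHAT IS PROVED (0 sorry; every `d`, read-out torus `Tor M`, `Lc ≥ 2`)
* §1 form level: `effInf_quad_sub_nonneg` (`0 ≤ re⟨B,(effInf − effAction k)B⟩`, P4) and **`effInf_quad_sub_le`**:
  `re⟨B,(effInf − effAction k)B⟩ ≤ 2·Crate d·(Lc^k)⁻²·d1Sq M B = Crate d·(Lc^k)⁻²·curlEnergy M B`.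
* §2 Loewner level: `rateBound k := (Crate d·(Lc^k)⁻²) • curlMatᴴcurlMat`; **`effInf_sub_effAction_le`**: `effInf − effAction k ≤ rateBound k`;
  **`effAction_succ_sub_le`**: `0 ≤ effAction (k+1) − effAction k ≤ rateBound k` (the ONE-STEP rate, `θ = Lc⁻²`); `effAction_sub_le` (tails `k ≤ k′`).
* §3 Bałaban's `Δ_k` itself (`DelK`, any `a > 0`, = `½·effAction k` by P4's `effAction_eq_two_smul_DelK`): **`DelK_quad_rate`**:
  `0 ≤ re⟨B,(½effInf − Δ_{Lc^k})B⟩ ≤ Crate d·(Lc^k)⁻²·d1Sq M B`.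
* §4 entrywise: **`norm_effInf_sub_effAction_apply_le`**: `‖(effInf − effAction k) a b‖ ≤ Crate d·(Lc^k)⁻²·√(re K_aa · re K_bb)`, `K = curlMatᴴcurlMat`.
WHAT THIS IS NOT: no statement about minimisers `H_k`, propagators `G_k`, composites, position-space decay, `U ≠ 1`; the constant `Crate d` is the
tree's (asym1∕b05), not optimised; NOT (CONV-C) as typed (`DirichletExhaustion.ConvC`∕`convC_balaban` are the ℤ^{d+1} statements of this road),
NOT D1, NOT BetaPertH, NOT continuum, NOT Clay.
-/

noncomputable section

namespace Summit.QuantumFields.BalabanUV.Beta.GAN24.MonotoneTorusRate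

open Matrix Filter Topology
open scoped BigOperators ComplexOrder
open Literature.MathematicalPhysics.QuantumFieldTheory.Balaban1983to89
open Literature.MathematicalPhysics.QuantumFieldTheory.Balaban1983to89.B5Prop11Plancherel (Tor)
open Literature.MathematicalPhysics.QuantumFieldTheory.Balaban1983to89.B5Bounds167Lattice (d1Sq formDk)
open Literature.MathematicalPhysics.QuantumFieldTheory.Balaban1983to89.B5ActionRate166 (Crate Crate_nonneg formDk_limit)
open Literature.MathematicalPhysics.QuantumFieldTheory.Balaban1983to89.Beta.BlockEffectiveAction (DelK)
open Summit.QuantumFields.BalabanUV.Beta.GAN24.MonotoneLoewner (posSemidef_of_isHermitian_re_nonneg norm_apply_sq_le)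
open Summit.QuantumFields.BalabanUV.Beta.GAN24.MonotoneCovLimit (posSemidef_sub_of_mono)
open Summit.QuantumFields.BalabanUV.Beta.GAN24.MonotoneTorusTower (curlMat curlEnergy curlEnergy_nonneg quad_curlMat)
open Summit.QuantumFields.BalabanUV.Beta.GAN24.MonotoneTorusEffective (effAction effAction_isHermitian effAction_posSemidef effAction_step_mono
  effAction_quad_eq_two_formDk effAction_eq_two_smul_DelK one_le_pow_Lc)
open Summit.QuantumFields.BalabanUV.Beta.GAN24.MonotoneTorusEffectiveLimit (effInf effInf_posSemidef effAction_le_effInf d1Sq_eq_half_curlEnergy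
  half_effInf_quad_eq_formDk_limit)

variable {d : ℕ} (Lc : ℕ) [NeZero Lc] (M : Fin d → ℕ) [hM : ∀ μ, NeZero (M μ)]

/-! ## §1 Form level: the squeeze `0 ≤ re⟨B,(effInf − effAction k)B⟩ ≤ 2·Crate·Lc^{−2k}·d1Sq B` -/

/-- the rate constant at level `k`: `Crate d · (Lc^k)⁻²` (the tree's `B5ActionRate166.Crate`, `θ = Lc⁻²`). [folklore] -/
def eps (d Lc k : ℕ) : ℝ := Crate d * (((Lc : ℝ) ^ k)⁻¹) ^ 2

omit [NeZero Lc] in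
/-- `0 ≤ eps`. [folklore] -/
theorem eps_nonneg (k : ℕ) : 0 ≤ eps d Lc k := mul_nonneg (Crate_nonneg d) (by positivity)

omit [NeZero Lc] in
/-- `eps d Lc (k+1) ≤ eps d Lc k` (the bound improves along the tower; `Lc ≥ 1`). [folklore] -/
theorem eps_succ_le (hL : 1 ≤ Lc) (k : ℕ) : eps d Lc (k + 1) ≤ eps d Lc k := by
  unfold eps
  have hL' : (1 : ℝ) ≤ Lc := by exact_mod_cast hL
  have hk : (0 : ℝ) < (Lc : ℝ) ^ k := by positivity
  refine mul_le_mul_of_nonneg_left ?_ (Crate_nonneg d)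
  have h1 : ((Lc : ℝ) ^ (k + 1))⁻¹ ≤ ((Lc : ℝ) ^ k)⁻¹ := by
    apply inv_anti₀ hk
    rw [pow_succ]
    exact le_mul_of_one_le_right hk.le hL'
  have h0 : 0 ≤ ((Lc : ℝ) ^ (k + 1))⁻¹ := by positivity
  nlinarith

/-- `re⟨B, effAction k B⟩ = 2·formDk (Lc^k) M B` (P4's junction with the printed (1.66) form, real part). [folklore] -/
theorem effAction_quad_re (k : ℕ) (B : Tor M × Fin d → ℂ) :
    (star B ⬝ᵥ (effAction Lc M k *ᵥ B)).re = 2 * formDk (Lc ^ k) M B := by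
  rw [effAction_quad_eq_two_formDk]; norm_cast

/-- **LOWER HALF** (road P4): `0 ≤ re⟨B,(effInf − effAction k)B⟩`. [folklore] -/
theorem effInf_quad_sub_nonneg (k : ℕ) (B : Tor M × Fin d → ℂ) :
    0 ≤ (star B ⬝ᵥ ((effInf Lc M - effAction Lc M k) *ᵥ B)).re :=
  (Complex.nonneg_iff.mp ((effAction_le_effInf Lc M k).dotProduct_mulVec_nonneg B)).1

/-- **UPPER HALF WITH RATE**: `re⟨B,(effInf − effAction k)B⟩ ≤ 2·Crate d·(Lc^k)⁻²·d1Sq M B` for `Lc ≥ 2` — the tree's `formDk_limit` rate transported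
to road P4's limit object through `half_effInf_quad_eq_formDk_limit` (uniqueness of limits). [folklore] -/
theorem effInf_quad_sub_le (hL : 2 ≤ Lc) (k : ℕ) (B : Tor M × Fin d → ℂ) :
    (star B ⬝ᵥ ((effInf Lc M - effAction Lc M k) *ᵥ B)).re ≤ 2 * eps d Lc k * d1Sq M B := by
  obtain ⟨Finf, ht, hb⟩ := formDk_limit (M := M) Lc hL B
  have h1 := half_effInf_quad_eq_formDk_limit Lc M B ht
  have h2 := effAction_quad_re Lc M k B
  have h3 := hb k
  rw [sub_mulVec, dotProduct_sub, Complex.sub_re, h2]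
  have h4 : (star B ⬝ᵥ (effInf Lc M *ᵥ B)).re = 2 * Finf := by linarith
  rw [h4, eps]
  have h5 := (abs_sub_le_iff.mp h3).2
  linarith

/-- the same in `curlEnergy` currency: `re⟨B,(effInf − effAction k)B⟩ ≤ Crate d·(Lc^k)⁻²·curlEnergy M B` (`d1Sq = ½·curlEnergy`). [folklore] -/
theorem effInf_quad_sub_le_curlEnergy (hL : 2 ≤ Lc) (k : ℕ) (B : Tor M × Fin d → ℂ) :
    (star B ⬝ᵥ ((effInf Lc M - effAction Lc M k) *ᵥ B)).re ≤ eps d Lc k * curlEnergy M B := by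
  have h := effInf_quad_sub_le Lc M hL k B
  rw [d1Sq_eq_half_curlEnergy] at h
  linarith

/-! ## §2 Loewner level: `effInf − effAction k ≤ eps_k • curlMatᴴcurlMat`, and the one-step ∕ tail rates -/

/-- the Loewner majorant at level `k`: `eps_k • curlMatᴴ curlMat`. [folklore] -/
def rateBound (k : ℕ) : Matrix (Tor M × Fin d) (Tor M × Fin d) ℂ := ((eps d Lc k : ℝ) : ℂ) • ((curlMat M)ᴴ * curlMat M)

omit [NeZero Lc] in
/-- `rateBound k` is Hermitian. [folklore] -/
theorem rateBound_isHermitian (k : ℕ) : (rateBound Lc M k).IsHermitian :=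
  (Matrix.isHermitian_conjTranspose_mul_self _).smul (by rw [IsSelfAdjoint, Complex.star_def, Complex.conj_ofReal])

omit [NeZero Lc] in
/-- the form of `rateBound k` is `eps_k · curlEnergy`. [folklore] -/
theorem rateBound_quad_re (k : ℕ) (B : Tor M × Fin d → ℂ) :
    (star B ⬝ᵥ (rateBound Lc M k *ᵥ B)).re = eps d Lc k * curlEnergy M B := by
  rw [rateBound, smul_mulVec, dotProduct_smul, quad_curlMat, smul_eq_mul, ← Complex.ofReal_mul, Complex.ofReal_re]

omit [NeZero Lc] in
/-- `rateBound k` is PSD. [folklore] -/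
theorem rateBound_posSemidef (k : ℕ) : (rateBound Lc M k).PosSemidef :=
  posSemidef_of_isHermitian_re_nonneg (rateBound_isHermitian Lc M k) fun B => by
    rw [rateBound_quad_re]; exact mul_nonneg (eps_nonneg Lc k) (curlEnergy_nonneg M B)

omit [NeZero Lc] in
/-- `rateBound (k+1) ≤ rateBound k` (`Lc ≥ 1`). [folklore] -/
theorem rateBound_succ_le (hL : 1 ≤ Lc) (k : ℕ) : (rateBound Lc M k - rateBound Lc M (k + 1)).PosSemidef :=
  posSemidef_of_isHermitian_re_nonneg ((rateBound_isHermitian Lc M k).sub (rateBound_isHermitian Lc M (k + 1))) fun B => by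
    rw [sub_mulVec, dotProduct_sub, Complex.sub_re, rateBound_quad_re, rateBound_quad_re]
    have := eps_succ_le (d := d) Lc hL k
    nlinarith [curlEnergy_nonneg M B]

/-- **`effInf − effAction k ≤ rateBound k`** (Loewner): road P4's limit object is within `Crate·Lc^{−2k}·curlᴴcurl` of EVERY level. [folklore] -/
theorem effInf_sub_effAction_le (hL : 2 ≤ Lc) (k : ℕ) :
    (rateBound Lc M k - (effInf Lc M - effAction Lc M k)).PosSemidef := by
  refine posSemidef_of_isHermitian_re_nonneg ((rateBound_isHermitian Lc M k).sub (effAction_le_effInf Lc M k).isHermitian) fun B => ?_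
  rw [sub_mulVec, dotProduct_sub, Complex.sub_re, rateBound_quad_re]
  have h := effInf_quad_sub_le_curlEnergy Lc M hL k B
  linarith

/-- **THE ONE-STEP RATE** (`θ = Lc⁻²`): `0 ≤ effAction (k+1) − effAction k ≤ rateBound k`. [folklore] -/
theorem effAction_succ_sub_le (hL : 2 ≤ Lc) (k : ℕ) :
    (effAction Lc M (k + 1) - effAction Lc M k).PosSemidef
      ∧ (rateBound Lc M k - (effAction Lc M (k + 1) - effAction Lc M k)).PosSemidef := by
  refine ⟨effAction_step_mono Lc M k, ?_⟩
  have h := (effInf_sub_effAction_le Lc M hL k).add (effAction_le_effInf Lc M (k + 1))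
  have e : rateBound Lc M k - (effInf Lc M - effAction Lc M k) + (effInf Lc M - effAction Lc M (k + 1))
      = rateBound Lc M k - (effAction Lc M (k + 1) - effAction Lc M k) := by abel
  rw [e] at h; exact h

/-- **TAILS**: `0 ≤ effAction k′ − effAction k ≤ rateBound k` for all `k ≤ k′`. [folklore] -/
theorem effAction_sub_le (hL : 2 ≤ Lc) {k k' : ℕ} (hkk' : k ≤ k') :
    (effAction Lc M k' - effAction Lc M k).PosSemidef
      ∧ (rateBound Lc M k - (effAction Lc M k' - effAction Lc M k)).PosSemidef := by
  refine ⟨posSemidef_sub_of_mono (effAction_step_mono Lc M) hkk', ?_⟩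
  have h := (effInf_sub_effAction_le Lc M hL k).add (effAction_le_effInf Lc M k')
  have e : rateBound Lc M k - (effInf Lc M - effAction Lc M k) + (effInf Lc M - effAction Lc M k')
      = rateBound Lc M k - (effAction Lc M k' - effAction Lc M k) := by abel
  rw [e] at h; exact h

/-! ## §3 Bałaban's `Δ_k` itself (`DelK`, any `a > 0`): `0 ≤ re⟨B,(Δ_∞ − Δ_{Lc^k})B⟩ ≤ Crate·Lc^{−2k}·d1Sq B`, `Δ_∞ = ½·effInf` -/

/-- **THE RATE FOR `Δ_k`**: with `Δ_∞ := ½·effInf` (P4's `DelK_tendsto_half_effInf`), for every `a > 0`, `Lc ≥ 2`, `k`, `B`: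
`0 ≤ re⟨B,(Δ_∞ − Δ_{Lc^k})B⟩ ≤ Crate d·(Lc^k)⁻²·d1Sq M B` — Bałaban's (1.66) block actions converge in the Loewner order at the geometric rate
`θ = Lc⁻²`, every torus, no hypothesis. [folklore] -/
theorem DelK_quad_rate (hL : 2 ≤ Lc) (k : ℕ) (a : ℝ) (ha : 0 < a) (B : Tor M × Fin d → ℂ) :
    0 ≤ (star B ⬝ᵥ (((2 : ℂ)⁻¹ • effInf Lc M - DelK (Lc ^ k) (one_le_pow_Lc Lc k) M a ha) *ᵥ B)).re
      ∧ (star B ⬝ᵥ (((2 : ℂ)⁻¹ • effInf Lc M - DelK (Lc ^ k) (one_le_pow_Lc Lc k) M a ha) *ᵥ B)).re ≤ eps d Lc k * d1Sq M B := by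
  have hD : DelK (Lc ^ k) (one_le_pow_Lc Lc k) M a ha = (2 : ℂ)⁻¹ • effAction Lc M k := by
    rw [effAction_eq_two_smul_DelK Lc M k a ha, smul_smul, inv_mul_cancel₀ two_ne_zero, one_smul]
  have e : (2 : ℂ)⁻¹ • effInf Lc M - DelK (Lc ^ k) (one_le_pow_Lc Lc k) M a ha = (2 : ℂ)⁻¹ • (effInf Lc M - effAction Lc M k) := by
    rw [hD, smul_sub]
  have hre : (star B ⬝ᵥ (((2 : ℂ)⁻¹ • (effInf Lc M - effAction Lc M k)) *ᵥ B)).re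
      = 2⁻¹ * (star B ⬝ᵥ ((effInf Lc M - effAction Lc M k) *ᵥ B)).re := by
    rw [smul_mulVec, dotProduct_smul, smul_eq_mul, Complex.mul_re]
    simp [Complex.inv_re, Complex.inv_im]
  rw [e, hre]
  have h0 := effInf_quad_sub_nonneg Lc M k B
  have h1 := effInf_quad_sub_le Lc M hL k B
  constructor
  · positivity
  · nlinarith

/-! ## §4 Entrywise: `‖(effInf − effAction k) a b‖ ≤ eps_k·√(re K_aa · re K_bb)`, `K = curlMatᴴcurlMat` -/

/-- the diagonal of the PSD gap is below the diagonal of the majorant: `re (effInf − effAction k) a a ≤ re (rateBound k) a a`. [folklore] -/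
theorem re_diag_sub_le (hL : 2 ≤ Lc) (k : ℕ) (a : Tor M × Fin d) :
    ((effInf Lc M - effAction Lc M k) a a).re ≤ ((rateBound Lc M k) a a).re := by
  have h := MonotoneLoewner.re_diag_nonneg (effInf_sub_effAction_le Lc M hL k) a
  rw [Matrix.sub_apply, Complex.sub_re] at h
  linarith

/-- **ENTRYWISE RATE**: `‖(effInf − effAction k) a b‖² ≤ re(rateBound k)_aa · re(rateBound k)_bb`, i.e. every entry of road P4's limit gap is
`≤ Crate·Lc^{−2k}·√(re K_aa·re K_bb)` with `K = curlMatᴴcurlMat` (a bond lies in finitely many plaquettes, so `K_aa` is a `d`-dependent integer). [folklore] -/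
theorem normSq_effInf_sub_effAction_apply_le (hL : 2 ≤ Lc) (k : ℕ) (a b : Tor M × Fin d) :
    ‖(effInf Lc M - effAction Lc M k) a b‖ ^ 2 ≤ ((rateBound Lc M k) a a).re * ((rateBound Lc M k) b b).re := by
  have hX := effAction_le_effInf Lc M k
  have h1 := norm_apply_sq_le hX a b
  have ha := re_diag_sub_le Lc M hL k a
  have hb := re_diag_sub_le Lc M hL k b
  have ha0 : 0 ≤ ((effInf Lc M - effAction Lc M k) a a).re := MonotoneLoewner.re_diag_nonneg hX a
  have hb0 : 0 ≤ ((effInf Lc M - effAction Lc M k) b b).re := MonotoneLoewner.re_diag_nonneg hX b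
  calc ‖(effInf Lc M - effAction Lc M k) a b‖ ^ 2 ≤ ((effInf Lc M - effAction Lc M k) a a).re * ((effInf Lc M - effAction Lc M k) b b).re := h1
    _ ≤ ((rateBound Lc M k) a a).re * ((rateBound Lc M k) b b).re := mul_le_mul ha hb hb0 (ha0.trans ha)

end Summit.QuantumFields.BalabanUV.Beta.GAN24.MonotoneTorusRate
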